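import Mathlib
import HarnessLib

/-!
# Cell pnp-psdrank, route `ChebyshevTracialDesign`: PARITY MASKS ARE INVISIBLE TO BALANCED MONOMIALS ON ODD SLICES
# (crux `TracialDecayExp20`, stmt-PneNP-19878; eng MEMO-17 (eng g18) §1.3, the 'pseudorandom remainder' example)

Engine brick (eng g18), theorems only (no definitions). The cut side of the crux lives on the odd slice
`C([n],t)` (`t` odd). For a half `H ⊆ [n]` the parity mask `χ_H(U) = (−1)^{|H ∩ U|}` is the multiplier behind the
example `X_U = 1[|U ∩ H| even]·u(U)u(U)ᵀ = ½·uuᵀ + ½·χ_H·uuᵀ` of MEMO-17 (eng) §1: a contraction field outside the four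
kernel cells SIGN ⊕ DOM ⊕ JUNK ⊕ slack whose signed half `χ_H·uuᵀ` is nevertheless harmless because `χ_H` has NO
correlation with low monomials. This file proves the exact form of that statement:
* §1 `card_filter_powersetCard_inter_card` — hypergeometric fibre count over a finset base `B ⊇ P`:
  `#{W ⊆ B : |W| = m, |P ∩ W| = g} = C(|P|, g)·C(|B| − |P|, m − g)`.
* §2 `sum_negOnePow_card_inter_eq_zero` — if `2|P| = |B|` and `m` is odd then `Σ_{W ⊆ B, |W| = m} (−1)^{|P ∩ W|} = 0`
  (group by `g = |P ∩ W|`, then the reflection `g ↦ m − g` reverses the sign of `(−1)^g C(p,g) C(p,m−g)`).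
* §3 `sum_negOnePow_card_inter_superset_eq_zero` — THE PINNED FORM: in a finite vertex type, for every `H`, every pin set
  `A` with `|H ∖ A| = |Hᶜ ∖ A|` ("balanced outside the pins") and every `t` with `t + |A|` odd,
  `Σ_{|U| = t, A ⊆ U} (−1)^{|H ∩ U|} = 0`; in particular (`A = ∅`, `2|H| = n`, `t` odd) `χ_H` has mean zero on the odd
  slice, and it is orthogonal to every monomial `1[A ⊆ U]` with `|A ∩ H| = |A ∖ H|` (MEMO-17 (eng) uses exactly this
  displayed identity; the UNBALANCED monomials see `χ_H` at size `2^{−n/2+O(|A|)}` — that estimate is not formalised here).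
[folklore] (alternating Vandermonde sum `Σ_g (−1)^g C(p,g)C(p,m−g) = [x^m](1−x²)^p = 0` for odd `m`).
Stature: support/instrument (elementary counting). WHAT THIS IS NOT: no statement about designs, psd strategies or psd
rank; no P-vs-NP content. Supports stmt-PneNP-19878 (evidence for the shape of the residual structure conjecture).
-/

set_option linter.dupNamespace false -- `Summit.PneNP.PneNP.…`: summit = sub-problem (D-0017)

namespace Summit.PneNP.PneNP.Theorems.ChebyshevTracialDesignParityMaskInvisible

open Finset

variable {α : Type*} [DecidableEq α]

/-! ### §1 Hypergeometric fibre count over a finset base -/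

/-- For `P ⊆ B` and `g ≤ m`: the `m`-subsets `W` of `B` with `|P ∩ W| = g` number `C(|P|, g)·C(|B| − |P|, m − g)`
(choose the part inside `P` and the rest in `B ∖ P`). [folklore] -/
theorem card_filter_powersetCard_inter_card (B P : Finset α) (hP : P ⊆ B) {m g : ℕ} (hg : g ≤ m) :
    ((B.powersetCard m).filter fun W => (P ∩ W).card = g).card =
      P.card.choose g * (B.card - P.card).choose (m - g) := by
  have hsd : (B \ P).card = B.card - P.card := card_sdiff_of_subset hP
  rw [← card_powersetCard g P, ← hsd, ← card_powersetCard (m - g) (B \ P), ← card_product]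
  refine card_bij' (fun W _ => (P ∩ W, W \ P)) (fun X _ => X.1 ∪ X.2) ?_ ?_ ?_ ?_
  · intro W hW
    simp only [mem_filter, mem_powersetCard] at hW
    obtain ⟨⟨hWB, hWm⟩, hWg⟩ := hW
    simp only [mem_product, mem_powersetCard]
    refine ⟨⟨inter_subset_left, hWg⟩, ⟨fun x hx => mem_sdiff.2 ⟨hWB (mem_sdiff.1 hx).1, (mem_sdiff.1 hx).2⟩, ?_⟩⟩
    have h1 := card_sdiff_add_card_inter W P
    rw [inter_comm] at h1
    omega
  · intro X hX
    obtain ⟨X1, X2⟩ := X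
    simp only [mem_product, mem_powersetCard] at hX
    obtain ⟨⟨h1P, h1g⟩, h2B, h2c⟩ := hX
    have hdisj : Disjoint X1 X2 := by
      rw [Finset.disjoint_left]
      intro x hx1 hx2
      exact (mem_sdiff.1 (h2B hx2)).2 (h1P hx1)
    have hPX : P ∩ (X1 ∪ X2) = X1 := by
      ext x
      simp only [mem_inter, mem_union]
      constructor
      · rintro ⟨hxP, h | h⟩
        · exact h
        · exact absurd hxP (mem_sdiff.1 (h2B h)).2
      · intro h
        exact ⟨h1P h, Or.inl h⟩
    simp only [mem_filter, mem_powersetCard]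
    refine ⟨⟨?_, ?_⟩, ?_⟩
    · intro x hx
      rcases mem_union.1 hx with h | h
      · exact hP (h1P h)
      · exact (mem_sdiff.1 (h2B h)).1
    · rw [card_union_of_disjoint hdisj]
      have : g ≤ P.card := by rw [← h1g]; exact card_le_card h1P
      omega
    · rw [hPX]; exact h1g
  · intro W hW
    ext x
    simp only [mem_union, mem_inter, mem_sdiff]
    tauto
  · intro X hX
    obtain ⟨X1, X2⟩ := X
    simp only [mem_product, mem_powersetCard] at hX
    obtain ⟨⟨h1P, _⟩, h2B, _⟩ := hX
    simp only [Prod.mk.injEq]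
    constructor
    · ext x
      simp only [mem_inter, mem_union]
      constructor
      · rintro ⟨hxP, h | h⟩
        · exact h
        · exact absurd hxP (mem_sdiff.1 (h2B h)).2
      · intro h
        exact ⟨h1P h, Or.inl h⟩
    · ext x
      simp only [mem_sdiff, mem_union]
      constructor
      · rintro ⟨h | h, hxP⟩
        · exact absurd (h1P h) hxP
        · exact h
      · intro h
        exact ⟨Or.inr h, (mem_sdiff.1 (h2B h)).2⟩

/-! ### §2 The alternating hypergeometric sum vanishes on odd layers of a balanced base -/

/-- In `ℤ`: for odd `m` and `g ≤ m`, `(−1)^{m−g} = −(−1)^g`. [folklore] -/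
theorem negOnePow_sub_of_odd {m g : ℕ} (hm : Odd m) (hg : g ≤ m) : (-1 : ℤ) ^ (m - g) = -(-1) ^ g := by
  have h : (-1 : ℤ) ^ (m - g) * (-1) ^ g = -1 := by
    rw [← pow_add, Nat.sub_add_cancel hg, hm.neg_one_pow]
  have hsq : ((-1 : ℤ) ^ g) * (-1) ^ g = 1 := by rw [← pow_add, ← two_mul, pow_mul]; simp
  calc (-1 : ℤ) ^ (m - g) = (-1) ^ (m - g) * (-1) ^ g * (-1) ^ g := by rw [mul_assoc, hsq, mul_one]
    _ = -(-1) ^ g := by rw [h]; ring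

/-- **Parity has mean zero on odd layers of a balanced base.** If `P ⊆ B`, `2|P| = |B|` and `m` is odd, then
`Σ_{W ⊆ B, |W| = m} (−1)^{|P ∩ W|} = 0`. Proof: grouping by `g = |P ∩ W|` (§1) gives `Σ_g (−1)^g C(p,g) C(p,m−g)`, and the
reflection `g ↦ m − g` shows this sum equals its own negative. [folklore] -/
theorem sum_negOnePow_card_inter_eq_zero (B P : Finset α) (hP : P ⊆ B) (hbal : 2 * P.card = B.card)
    {m : ℕ} (hm : Odd m) :
    ∑ W ∈ B.powersetCard m, (-1 : ℤ) ^ (P ∩ W).card = 0 := by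
  set p := P.card with hp
  -- fibrewise by g = |P ∩ W|
  have hmaps : ∀ W ∈ B.powersetCard m, (P ∩ W).card ∈ range (m + 1) := by
    intro W hW
    rw [mem_powersetCard] at hW
    rw [mem_range]
    have := card_le_card (inter_subset_right : P ∩ W ⊆ W)
    omega
  have hfib : ∑ W ∈ B.powersetCard m, (-1 : ℤ) ^ (P ∩ W).card =
      ∑ g ∈ range (m + 1), ((p.choose g * p.choose (m - g) : ℕ) : ℤ) * (-1) ^ g := by
    rw [← sum_fiberwise_of_maps_to hmaps]
    refine sum_congr rfl fun g hg => ?_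
    have hgm : g ≤ m := by rw [mem_range] at hg; omega
    have hBp : B.card - p = p := by omega
    rw [sum_congr rfl fun W hW => by rw [(mem_filter.1 hW).2], sum_const, nsmul_eq_mul,
      card_filter_powersetCard_inter_card B P hP hgm, ← hp, hBp]
  rw [hfib]
  -- reflection g ↦ m − g
  set f : ℕ → ℤ := fun g => ((p.choose g * p.choose (m - g) : ℕ) : ℤ) * (-1) ^ g with hf
  have hrefl := sum_range_reflect f (m + 1)
  have hneg : ∑ g ∈ range (m + 1), f (m + 1 - 1 - g) = -∑ g ∈ range (m + 1), f g := by
    rw [← sum_neg_distrib]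
    refine sum_congr rfl fun g hg => ?_
    have hgm : g ≤ m := by rw [mem_range] at hg; omega
    have hmg : m + 1 - 1 - g = m - g := by omega
    rw [hmg, hf]
    simp only
    rw [Nat.sub_sub_self hgm, negOnePow_sub_of_odd hm hgm, mul_comm (p.choose (m - g)) (p.choose g)]
    ring
  have h2 : ∑ g ∈ range (m + 1), f g = -∑ g ∈ range (m + 1), f g := by rw [← hneg, hrefl]
  linarith

/-! ### §3 The pinned form on the odd slice of a finite vertex type -/

/-- **Parity masks are invisible to balanced monomials on odd slices.** In a finite vertex type, let `H` be any vertex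
set and `A` a pin set with `|H ∖ A| = |Hᶜ ∖ A|` (the part of the ground set outside the pins is split evenly by `H`), and
let `t + |A|` be odd. Then `Σ_{|U| = t, A ⊆ U} (−1)^{|H ∩ U|} = 0`, i.e. `E_U[χ_H(U)·1[A ⊆ U]] = 0` on the slice
`C([n],t)`. With `A = ∅`: for `2|H| = n` and `t` odd the parity `χ_H` has mean zero on the odd slice; in general the
monomials `1[A ⊆ U]` with `|A ∩ H| = |A ∖ H|` (then `|H ∖ A| = |Hᶜ ∖ A|` iff `2|H| = n`) are exactly orthogonal to `χ_H`.
Proof: `U ↦ U ∖ A` is a bijection onto the `(t − |A|)`-subsets of `Aᶜ`, `|H ∩ U| = |H ∩ A| + |(H ∖ A) ∩ (U ∖ A)|`, and §2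
applies to the base `Aᶜ ⊇ H ∖ A`. [folklore] -/
theorem sum_negOnePow_card_inter_superset_eq_zero [Fintype α] (H A : Finset α) (t : ℕ)
    (hbal : (H \ A).card = (Hᶜ \ A).card) (hodd : Odd (t + A.card)) :
    ∑ U ∈ (univ.powersetCard t).filter (fun U => A ⊆ U), (-1 : ℤ) ^ (H ∩ U).card = 0 := by
  by_cases hAt : A.card ≤ t
  swap
  · -- no `t`-set contains `A`
    have hempty : (univ.powersetCard t).filter (fun U : Finset α => A ⊆ U) = ∅ := by
      refine filter_eq_empty_iff.2 fun U hU hAU => ?_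
      rw [mem_powersetCard] at hU
      have := card_le_card hAU
      omega
    rw [hempty, sum_empty]
  set m := t - A.card with hm
  have hmodd : Odd m := by
    rcases hodd with ⟨k, hk⟩
    refine ⟨k - A.card, ?_⟩
    omega
  set B : Finset α := Aᶜ with hB
  set P : Finset α := H \ A with hPdef
  have hPB : P ⊆ B := by
    intro x hx
    rw [hB, mem_compl]
    exact (mem_sdiff.1 hx).2
  have hBcard : B.card = (H \ A).card + (Hᶜ \ A).card := by
    have hdisj : Disjoint (H \ A) (Hᶜ \ A) := by
      rw [Finset.disjoint_left]
      intro x hx hx'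
      exact (mem_compl.1 (mem_sdiff.1 hx').1) (mem_sdiff.1 hx).1
    rw [← card_union_of_disjoint hdisj]
    congr 1
    ext x
    simp only [hB, mem_compl, mem_union, mem_sdiff]
    tauto
  have hbal2 : 2 * P.card = B.card := by rw [hBcard, hPdef, ← hbal]; ring
  -- reindex U ↦ U \ A
  have hre : ∑ U ∈ (univ.powersetCard t).filter (fun U => A ⊆ U), (-1 : ℤ) ^ (H ∩ U).card =
      ∑ W ∈ B.powersetCard m, (-1 : ℤ) ^ ((H ∩ A).card + (P ∩ W).card) := by
    refine sum_bij' (fun U _ => U \ A) (fun W _ => W ∪ A) ?_ ?_ ?_ ?_ ?_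
    · intro U hU
      simp only [mem_filter, mem_powersetCard, subset_univ, true_and] at hU
      obtain ⟨hUt, hAU⟩ := hU
      rw [mem_powersetCard]
      refine ⟨fun x hx => by rw [hB, mem_compl]; exact (mem_sdiff.1 hx).2, ?_⟩
      rw [card_sdiff_of_subset hAU]
      omega
    · intro W hW
      rw [mem_powersetCard] at hW
      obtain ⟨hWB, hWm⟩ := hW
      have hdisj : Disjoint W A := by
        rw [Finset.disjoint_left]
        intro x hxW hxA
        exact (mem_compl.1 (by simpa [hB] using hWB hxW)) hxA
      simp only [mem_filter, mem_powersetCard, subset_univ, true_and]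
      refine ⟨?_, subset_union_right⟩
      rw [card_union_of_disjoint hdisj]
      omega
    · intro U hU
      simp only [mem_filter, mem_powersetCard, subset_univ, true_and] at hU
      exact sdiff_union_of_subset hU.2
    · intro W hW
      rw [mem_powersetCard] at hW
      obtain ⟨hWB, _⟩ := hW
      ext x
      simp only [mem_sdiff, mem_union]
      constructor
      · rintro ⟨h | h, hxA⟩
        · exact h
        · exact absurd h hxA
      · intro h
        exact ⟨Or.inl h, mem_compl.1 (by simpa [hB] using hWB h)⟩
    · intro U hU
      simp only [mem_filter, mem_powersetCard, subset_univ, true_and] at hU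
      obtain ⟨_, hAU⟩ := hU
      congr 1
      -- |H ∩ U| = |H ∩ A| + |(H \ A) ∩ (U \ A)|
      have hsplit : H ∩ U = (H ∩ A) ∪ (P ∩ (U \ A)) := by
        ext x
        simp only [mem_inter, mem_union, hPdef, mem_sdiff]
        constructor
        · rintro ⟨hxH, hxU⟩
          by_cases hxA : x ∈ A
          · exact Or.inl ⟨hxH, hxA⟩
          · exact Or.inr ⟨⟨hxH, hxA⟩, hxU, hxA⟩
        · rintro (⟨hxH, hxA⟩ | ⟨⟨hxH, _⟩, hxU, _⟩)
          · exact ⟨hxH, hAU hxA⟩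
          · exact ⟨hxH, hxU⟩
      have hdisj : Disjoint (H ∩ A) (P ∩ (U \ A)) := by
        rw [Finset.disjoint_left]
        rintro x hx hx'
        exact (mem_sdiff.1 (mem_inter.1 hx').2).2 (mem_inter.1 hx).2
      rw [hsplit, card_union_of_disjoint hdisj]
  rw [hre]
  simp_rw [pow_add]
  rw [← mul_sum, sum_negOnePow_card_inter_eq_zero B P hPB hbal2 hmodd, mul_zero]

end Summit.PneNP.PneNP.Theorems.ChebyshevTracialDesignParityMaskInvisible
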